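import Literature.Analysis.FluidPDE.FractionalNSPrescribedEnergyProlongationProofs
import Literature.Analysis.FluidPDE.FracNSGalerkinAssembly
import HarnessLib

/-!
# Colombo–De Lellis–De Rosa 2018, prolongation of regular solutions (discharge under its own name)

Topic `Literature/Analysis/FluidPDE`. The named fact `ColomboDeLellisDeRosa2018_prolongation`
(`FractionalNSPrescribedEnergy.lean`; M. Colombo, C. De Lellis, L. De Rosa, *Ill-posedness of
Leray solutions for the hypodissipative Navier–Stokes equations*, Comm. Math. Phys. 362 (2018), §1,
paragraph after Thm. 1.3: a space–time Hölder solution on `[0, T]` is prolonged by a Leray solution)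
is proved in the tree in assembled form: `ColomboDeLellisDeRosa2018_prolongation_of_thm11`
(`FractionalNSPrescribedEnergyProlongationProofs.lean`) reduces it to the existence theorem
`ColomboDeLellisDeRosa2018_thm11`, discharged as `ColomboDeLellisDeRosa2018_thm11_holds`
(`FracNSGalerkinAssembly.lean`). No theorem of type `ColomboDeLellisDeRosa2018_prolongation` was
recorded; this leaf records the discharge under the fact's own name. No new definitions, no new
named facts.
-/

namespace Literature.Analysis

/-- **Colombo–De Lellis–De Rosa 2018, §1 (prolongation by a Leray solution), discharged**: the
named fact `FluidPDE.ColomboDeLellisDeRosa2018_prolongation` holds, by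
`FluidPDE.ColomboDeLellisDeRosa2018_prolongation_of_thm11` and the landed existence theorem
`FluidPDE.ColomboDeLellisDeRosa2018_thm11_holds`. Not to be confused with the Barriers-side
`Barriers.NavierStokesRegularity.ColomboDeLellisDeRosa2018_prolongation_holds`
(`HypodissipativeLerayNonuniquenessProofs.lean`), which discharges a differently typed local
proposition of the same name. [cite: ColomboDelellisDerosa2018, §1, paragraph after Thm. 1.3] -/
theorem FluidPDE.ColomboDeLellisDeRosa2018_prolongation_holds :
    FluidPDE.ColomboDeLellisDeRosa2018_prolongation :=
  FluidPDE.ColomboDeLellisDeRosa2018_prolongation_of_thm11 FluidPDE.ColomboDeLellisDeRosa2018_thm11_holds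

end Literature.Analysis
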